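import Mathlib
import Literature.Computability.Complexity.RangeAvoidance
import Literature.Computability.Complexity.SignDegreeXor
import Literature.Computability.MetaComplexity.ResLin
import Literature.Computability.MetaComplexity.ResLinProverDelayer
import Literature.Computability.MetaComplexity.PolynomialCalculus
import HarnessLib.Audit
import Summits.PneNP.PneNP.Theorems.PstarPDT
import Summits.PneNP.PneNP.Theorems.PstarFibreCNF
import Summits.PneNP.PneNP.Theorems.PstarFibrePolys
import Summits.PneNP.PneNP.Theorems.PstarPDTResLin
import Summits.PneNP.PneNP.Theorems.PstarPDTPolyCalc
import Summits.PneNP.PneNP.Theorems.PstarSAHeadline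
import Summits.PneNP.PneNP.Theorems.PstarExpandingExist

/-!
# ROUND-24 research statements: tree-like `Res(⊕)` / parity decision trees on pure-`P⋆` fibres

FRONTIER range-avoidance ladder, rung F-N3, ROUND 24 (cell `pnp-ideate`, planner seat p3; restricted-model proof complexity —
nothing here bears on `P` versus `NP`).

**Setting.** `I : LocalMap 4 n m` is a pure `P⋆`-instance (`P⋆(u) = u₀ ⊕ u₁ ⊕ (u₂ ∧ u₃)` = `xorAndPred`, injective positions per
output), `y ∉ I.range` a non-image target.  Three calibrations of "the fibre `I(z) = y` is hard to refute":
* the library-native one — a DELAYER strategy in the Itsykson–Sokolov / Gryaznov–Ovcharov–Riazanov game on the width-4 fibre CNF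
  `PstarFibreCNF.fibreCNF I y` guaranteeing `n / c` coins (`ProverDelayer.Guarantees`), which gives AT ONCE tree-like `Res(⊕)` length
  `≥ 2^{n/c}` (`ProverDelayer.two_pow_le_length_of_guarantees`) and parity-decision-tree size `≥ 2^{n/c-4}`, depth `≥ n/c - 4`
  for every tree solving the falsified-output search problem (`PstarPDTResLin.two_pow_le_size_of_guarantees`, T24.3a);
* the parity-decision-tree forms (`PstarPDT.PDT`, `Solves`, `size`, `depth`, T24.0);
* the `PC/𝔽₂`-degree form (`PstarFibrePolys.fibrePolys`, the named open problem T21.2), which is STRONGER than the PDT-depth form by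
  T24.3b (`PstarPDTPolyCalc.pc_refutable_of_solves : T.Solves I y → PC.RefutableInDegree (fibrePolys I y) (T.depth + 2)`).

**What this file declares** (all `@[conjecture]`, i.e. research statements of the cell, not literature facts):
`PstarDelayerLinear`, `PstarTreeResLinExp`, `PstarPDTSizeExp`, `PstarPDTDepthLinear`, `PstarPCDegreeLinear` — the "some pure-`P⋆`
family at every linear stretch" (∃-family) forms — and the MECHANISM form `ExpanderPDTDepth` ("boundary expansion of a typed pure
instance forces linear parity-decision-tree depth on every non-image fibre"), with the proved wirings
`PstarDelayerLinear → PstarTreeResLinExp`, `PstarDelayerLinear → PstarPDTSizeExp → PstarPDTDepthLinear`,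
`PstarPCDegreeLinear → PstarPDTDepthLinear` (T24.3b, `PstarPDT.pc_refutable_of_solves`) and `ExpanderPDTDepth → PstarPDTDepthLinear`
(through the landed supply theorem `PstarExpandingExist.expandingTypedExist'`).

**Scoping (referee g43, 2026-08-28).** (1) FAMILY SCOPING: the headline forms quantify `∃ I` (the expanding typed family is the
intended witness); naive "every typed pure family" forms are refutable in-tree — uniformly-random pure instances at `m ≥ 9(2N)²…`
are linearisable w.h.p. (`PstarUniformLinearisable.uniformLinearisable_whp`, T23.4) and linearisable fibres have shallow trees, while
linearisable instances are never boundary expanding (`PstarLinearisableNotExpanding.linearisable_not_boundaryExpandingQ`); the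
mechanism form is stated over `BoundaryExpanding` instances, which that theorem separates from the linearisable ones.
(2) DENSE RESIDUE: the SPARSE half of every statement below is already a theorem — `PstarPDTFromSA.lt_cost_of_solves`
(`SAFeasible t I y → T.Solves I y → t < cost T + k`, T24.6) with `PstarPDTFromSA.sparsePDTDepthLinear`: parity decision trees whose
queries have bounded support need depth `Ω(n)` on the `saLinearBlind` family, for EVERY target.  So the open content of each conjecture
is exactly the DENSE-parity (Gaussian-elimination) regime.  (3) CEILING: `PstarPDT.exists_solves_depth_le` (T24.2): depth
`≤ #andVars I + ⌈log₂ m⌉` always suffices — a Delayer can only collect on the AND layer.  (4) The `∀ y ∉ Range` quantifier is the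
conjectured form (kill test K1 of the R24 memo found no cheap target-specific refutation: local kills are excluded uniformly in `y` by
level-`n/c` SA feasibility, degree-0 kills by distinct AND pairs; what remains is an `𝔽₂`-Nullstellensatz-degree question, open).

**Placement.** These are instances of the proof-complexity-generator programme (Alekhnovich–Ben-Sasson–Razborov–Wigderson 2004;
Krajíček 2001/2004; Razborov 2015): "`y ∉ Range(NW_{A,P⋆})` is hard for tree-like `Res(⊕)`", base predicate the degree-2
Mossel–Shpilka–Trevisan predicate family (`x₀ + x₁ + x₂x₃` over `𝔽₂`; cf. Ren–Wang–Zhong, arXiv:2511.14061, Assumption 7.4 and Thm 8.1: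
`Res[⊕]` is closed under simple parity reductions).  Known: such generators are hard for Resolution and `PC/PCR` in odd characteristic
(ABRW04), for `R(ε log n)` (Razborov 2015); tree-like `Res(⊕)` lower bounds in print cover PHP, doubled Tseitin, orderings, BPHP and
lifted formulas (Itsykson–Sokolov 2014/2020; Gryaznov 2019; Efremenko–Garlík–Itsykson 2024; Chattopadhyay–Mande–Sanyal–Sherif 2023;
Beame–Koroth 2023) and, via `PC/𝔽₂` degree (Garlík–Kołodziejczyk 2018, Thm 14), random `k`-CNF — none covers XOR-AND generator
fibres, where the `PC/𝔽₂` route is itself open (T21.2).  A proof or a refutation of any statement here is FRONTIER material only.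
-/

set_option linter.dupNamespace false -- `Summit.PneNP.PneNP.…`: summit = sub-problem name (D-0017 single-conjunct layout)

open Finset Literature.Computability.Complexity Literature.Computability.MetaComplexity
open Literature.Computability.MetaComplexity.ProverDelayer (Strategy Guarantees two_pow_le_length_of_guarantees)
open Summit.PneNP.PneNP.Theorems.PstarPDT (PDT)
open Summit.PneNP.PneNP.Theorems.PstarFibreCNF (fibreCNF)
open Summit.PneNP.PneNP.Theorems.PstarFibrePolys (fibrePolys)
open Summit.PneNP.PneNP.Theorems.PstarTyped (Typed)
open Summit.PneNP.PneNP.Theorems.PstarSALevel (BoundaryExpanding)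
open Summit.PneNP.PneNP.Theorems.PstarSA2Blind (exists_not_mem_range)

namespace Summit.PneNP.PneNP.Theorems.PstarResLinConjectures

/-! ### The ∃-family (headline) forms -/

/-- **T24.R, library-native form (OPEN; ROUND-24 headline).**  At every linear stretch `C` there is `c > 0` such that for
infinitely many `n` some pure-`P⋆` instance with `m ≥ C·n` outputs has non-image targets, and on the fibre CNF of EVERY non-image
target some Delayer strategy guarantees `n / c` coins in the parity Prover–Delayer game.  Dense residue only: for Provers asking
bounded-support parities this is the theorem `PstarPDTFromSA.lt_cost_of_solves` (T24.6).  Intended witness family: the boundary-expanding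
typed instances of `PstarExpandingExist.expandingTypedExist'`; intended mechanism: `ExpanderPDTDepth` / the gap lemma of
`PstarGapLemma`.  FRONTIER; nothing here bears on `P ≠ NP`. -/
@[conjecture] def PstarDelayerLinear : Prop :=
  ∀ C : ℕ, ∃ c : ℕ, 0 < c ∧ ∀ N : ℕ, ∃ n, N ≤ n ∧ ∃ m, C * n ≤ m ∧ ∃ I : LocalMap 4 n m,
    I.IsPure xorAndPred ∧ (∃ y, y ∉ I.range) ∧
    ∀ y, y ∉ I.range → ∃ δ : Strategy, Guarantees (fibreCNF I y) δ (n / c)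

/-- **T24.R, tree-like `Res(⊕)` form (OPEN).**  Some pure-`P⋆` family at every linear stretch forces every TREE-LIKE `Res(⊕)`
refutation (`IsResLinRefutation` + every line used as a premise at most once) of the fibre CNF of every non-image target to length
`≥ 2^{n/c}`.  Follows from `PstarDelayerLinear` (`treeResLinExp_of_delayer`).  Dense residue only (T24.6).  FRONTIER. -/
@[conjecture] def PstarTreeResLinExp : Prop :=
  ∀ C : ℕ, ∃ c : ℕ, 0 < c ∧ ∀ N : ℕ, ∃ n, N ≤ n ∧ ∃ m, C * n ≤ m ∧ ∃ I : LocalMap 4 n m,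
    I.IsPure xorAndPred ∧ (∃ y, y ∉ I.range) ∧
    ∀ y, y ∉ I.range → ∀ π : List ResLinLine, IsResLinRefutation (fibreCNF I y) π →
      (∀ i : ℕ, (π.map fun l => l.premises.count i).sum ≤ 1) → 2 ^ (n / c) ≤ π.length

/-- **T24.R, parity-decision-tree size form (OPEN).**  Some pure-`P⋆` family at every linear stretch forces every parity decision
tree solving the falsified-output search problem of every non-image fibre to size `≥ 2^{n/c}`.  Follows from `PstarDelayerLinear`
(`pdtSizeExp_of_delayer`, via T24.3a).  Dense residue only (T24.6).  FRONTIER. -/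
@[conjecture] def PstarPDTSizeExp : Prop :=
  ∀ C : ℕ, ∃ c : ℕ, 0 < c ∧ ∀ N : ℕ, ∃ n, N ≤ n ∧ ∃ m, C * n ≤ m ∧ ∃ I : LocalMap 4 n m,
    I.IsPure xorAndPred ∧ (∃ y, y ∉ I.range) ∧
    ∀ y, y ∉ I.range → ∀ T : PDT n m, T.Solves I y → 2 ^ (n / c) ≤ T.size

/-- **T24.R, parity-decision-tree depth form (OPEN; the weakest dense form).**  Some pure-`P⋆` family at every linear stretch forces
every parity decision tree solving the falsified-output search problem of every non-image fibre to depth `≥ n/c - 1`.  The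
bounded-support ("sparse") case is the theorem `PstarPDTFromSA.sparsePDTDepthLinear`; the general case follows from `PstarPDTSizeExp`
(`pdtDepthLinear_of_sizeExp`), from `ExpanderPDTDepth` (`pdtDepthLinear_of_expander`) and from `PstarPCDegreeLinear`
(`pdtDepthLinear_of_pcDegree`, T24.3b).  Ceiling `PstarPDT.exists_solves_depth_le`.  FRONTIER. -/
@[conjecture] def PstarPDTDepthLinear : Prop :=
  ∀ C : ℕ, ∃ c : ℕ, 0 < c ∧ ∀ N : ℕ, ∃ n, N ≤ n ∧ ∃ m, C * n ≤ m ∧ ∃ I : LocalMap 4 n m,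
    I.IsPure xorAndPred ∧ (∃ y, y ∉ I.range) ∧
    ∀ y, y ∉ I.range → ∀ T : PDT n m, T.Solves I y → n ≤ c * (T.depth + 1)

/-- **T21.2 in Lean shape (NAMED OPEN PROBLEM).**  Some pure-`P⋆` family at every linear stretch forces `PC/𝔽₂` refutations of the
fibre polynomial system (`PstarFibrePolys.fibrePolys`: `pstarPoly I j + y j` and the Boolean axioms) of every non-image target to
degree `> n/c`.  The Alekhnovich–Razborov / Mikša–Nordström expansion method is void here (the `𝔽₂`-encoding of `P⋆` has immunity 1);
stronger than `PstarPDTDepthLinear` by T24.3b.  FRONTIER. -/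
@[conjecture] def PstarPCDegreeLinear : Prop :=
  ∀ C : ℕ, ∃ c : ℕ, 0 < c ∧ ∀ N : ℕ, ∃ n, N ≤ n ∧ ∃ m, C * n ≤ m ∧ ∃ I : LocalMap 4 n m,
    I.IsPure xorAndPred ∧ (∃ y, y ∉ I.range) ∧
    ∀ y, y ∉ I.range → ¬ PC.RefutableInDegree (fibrePolys I y) (n / c)

/-! ### The mechanism form -/

/-- **Expansion forces parity-decision-tree depth (OPEN; the R24 mechanism conjecture).**  There is an absolute `c` such that on
every pure typed `P⋆` instance that is `(r, 3/2)`-boundary expanding (`PstarSALevel.BoundaryExpanding r`), every parity decision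
tree solving the falsified-output search problem of ANY non-image fibre has depth `≥ r/c - 1`.  The Ben-Sasson–Wigderson /
Alekhnovich–Razborov shape "expansion ⇒ hardness" for the parity query model; bounded-support trees: theorem (T24.6 with T21.1′).
Not refuted by the linearisable mechanism: `PstarLinearisableNotExpanding.linearisable_not_boundaryExpandingQ`.  Intended proof: an
adversary keeping the answer space `r`-feasible, recovered each round by the gap lemma (`PstarGapLemma`).  FRONTIER. -/
@[conjecture] def ExpanderPDTDepth : Prop :=
  ∃ c : ℕ, 0 < c ∧ ∀ (n m r : ℕ) (I : LocalMap 4 n m), I.IsPure xorAndPred → Typed I → BoundaryExpanding r I →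
    ∀ y, y ∉ I.range → ∀ T : PDT n m, T.Solves I y → r ≤ c * (T.depth + 1)

/-! ### Proved wirings -/

/-- The Delayer form gives the tree-like `Res(⊕)` form (`ProverDelayer.two_pow_le_length_of_guarantees`). -/
theorem treeResLinExp_of_delayer (h : PstarDelayerLinear) : PstarTreeResLinExp := by
  intro C
  obtain ⟨c, hc, hN⟩ := h C
  refine ⟨c, hc, fun N => ?_⟩
  obtain ⟨n, hn, m, hm, I, hI, hne, hall⟩ := hN N
  refine ⟨n, hn, m, hm, I, hI, hne, fun y hy π hπ htree => ?_⟩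
  obtain ⟨δ, hδ⟩ := hall y hy
  exact two_pow_le_length_of_guarantees hδ hπ htree

/-- The Delayer form gives the parity-decision-tree size form (T24.3a `PstarPDTResLin.two_pow_le_size_of_guarantees`, absorbing the
factor `2^4` of the leaf pinning into the constant: `c ↦ 2c`, `n ≥ 8c`). -/
theorem pdtSizeExp_of_delayer (h : PstarDelayerLinear) : PstarPDTSizeExp := by
  intro C
  obtain ⟨c, hc, hN⟩ := h C
  refine ⟨2 * c, by omega, fun N => ?_⟩
  obtain ⟨n, hn, m, hm, I, hI, hne, hall⟩ := hN (max N (8 * c))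
  refine ⟨n, (le_max_left _ _).trans hn, m, hm, I, hI, hne, fun y hy T hT => ?_⟩
  obtain ⟨δ, hδ⟩ := hall y hy
  have h1 : 2 ^ (n / c) ≤ 2 ^ 4 * T.size := PstarPDTResLin.two_pow_le_size_of_guarantees hδ hT
  have h8 : 8 * c ≤ n := (le_max_right _ _).trans hn
  -- `n / (2c) + 4 ≤ n / c`
  have h2 : n / (2 * c) + 4 ≤ n / c := by
    have e1 : n / (2 * c) = n / c / 2 := by rw [Nat.div_div_eq_div_mul, mul_comm]
    have e2 : 8 ≤ n / c := (Nat.le_div_iff_mul_le hc).2 (by simpa [mul_comm] using h8)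
    omega
  have h3 : 2 ^ (n / (2 * c) + 4) ≤ 2 ^ 4 * T.size := (Nat.pow_le_pow_right (by norm_num) h2).trans h1
  rw [pow_add] at h3
  have h4 : 0 < 2 ^ 4 := by norm_num
  nlinarith [h3]

/-- The size form gives the depth form (`size ≤ 2^depth`). -/
theorem pdtDepthLinear_of_sizeExp (h : PstarPDTSizeExp) : PstarPDTDepthLinear := by
  intro C
  obtain ⟨c, hc, hN⟩ := h C
  refine ⟨c, hc, fun N => ?_⟩
  obtain ⟨n, hn, m, hm, I, hI, hne, hall⟩ := hN N
  refine ⟨n, hn, m, hm, I, hI, hne, fun y hy T hT => ?_⟩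
  have h1 : 2 ^ (n / c) ≤ 2 ^ T.depth := (hall y hy T hT).trans (PDT.size_le_two_pow_depth T)
  have h2 : n / c ≤ T.depth := (Nat.pow_le_pow_iff_right (by norm_num)).1 h1
  have h3 : n < (n / c + 1) * c := by
    have e1 := Nat.div_add_mod n c
    have e2 := Nat.mod_lt n hc
    nlinarith [e1, e2]
  nlinarith [h2, h3]

/-- The Delayer form gives the depth form. -/
theorem pdtDepthLinear_of_delayer (h : PstarDelayerLinear) : PstarPDTDepthLinear :=
  pdtDepthLinear_of_sizeExp (pdtSizeExp_of_delayer h)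

/-- The `PC/𝔽₂`-degree form gives the depth form (T24.3b: a depth-`d` parity decision tree solving the fibre yields a degree-`(d+2)`
refutation, `PstarPDT.pc_refutable_of_solves`; constant `c ↦ 2c`). -/
theorem pdtDepthLinear_of_pcDegree (h : PstarPCDegreeLinear) : PstarPDTDepthLinear := by
  intro C
  obtain ⟨c, hc, hN⟩ := h C
  refine ⟨2 * c, by omega, fun N => ?_⟩
  obtain ⟨n, hn, m, hm, I, hI, hne, hall⟩ := hN N
  refine ⟨n, hn, m, hm, I, hI, hne, fun y hy T hT => ?_⟩
  have h1 : PC.RefutableInDegree (fibrePolys I y) (T.depth + 2) := PstarPDT.pc_refutable_of_solves hI hT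
  have h2 : n / c < T.depth + 2 := by
    by_contra hle
    exact hall y hy (PC.DerivableInDegree.mono (Nat.le_of_not_lt hle) h1)
  have h3 : n < (n / c + 1) * c := by
    have e1 := Nat.div_add_mod n c
    have e2 := Nat.mod_lt n hc
    nlinarith [e1, e2]
  have h4 : (n / c + 1) * c ≤ (T.depth + 2) * c := Nat.mul_le_mul_right _ (by omega)
  nlinarith [h3, h4]

/-- **The mechanism form gives the headline depth form**, through the landed supply of boundary-expanding typed pure instances at
every linear stretch (`PstarExpandingExist.expandingTypedExist'`) and `PstarSA2Blind.exists_not_mem_range` (`n < m`). -/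
theorem pdtDepthLinear_of_expander (h : ExpanderPDTDepth) : PstarPDTDepthLinear := by
  obtain ⟨c, hc, hD⟩ := h
  intro C
  obtain ⟨c₁, hc₁, hE⟩ := PstarExpandingExist.expandingTypedExist' C
  refine ⟨2 * c₁ * c, by positivity, fun N => ?_⟩
  obtain ⟨n, hNn, m, hnm, hCm, I, hP, hT, hB⟩ := hE N
  refine ⟨n, hNn, m, hCm, I, hP, exists_not_mem_range I hnm, fun y hy T hTs => ?_⟩
  have h1 : n / c₁ ≤ c * (T.depth + 1) := hD n m (n / c₁) I hP hT hB y hy T hTs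
  have h2 : n < (n / c₁ + 1) * c₁ := by
    have e1 := Nat.div_add_mod n c₁
    have e2 := Nat.mod_lt n hc₁
    nlinarith [e1, e2]
  have h3 : (n / c₁ + 1) * c₁ ≤ (c * (T.depth + 1) + 1) * c₁ := Nat.mul_le_mul_right _ (by omega)
  have h5 : 1 ≤ c * (T.depth + 1) := Nat.mul_pos hc (Nat.succ_pos _)
  have h4 : (c * (T.depth + 1) + 1) * c₁ ≤ (2 * (c * (T.depth + 1))) * c₁ := Nat.mul_le_mul_right _ (by omega)
  have h6 : (2 * (c * (T.depth + 1))) * c₁ = 2 * c₁ * c * (T.depth + 1) := by ring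
  omega

end Summit.PneNP.PneNP.Theorems.PstarResLinConjectures
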